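import Literature.Analysis.FluidPDE.CKNPressureDuality
import HarnessLib

/-!
# The far part of the pressure and the dual splitting identity (Lemarié-Rieusset 2016, p. 469)

Analysis/FluidPDE support file (all results proved) in the decomposition of the named fact
`Literature.Analysis.FluidPDE.LemarieRieusset2016.lemma13_3` (Lemarié-Rieusset 2016,
Lemma 13.3), towards its pressure estimates (13.28)–(13.29) and (13.31) (pp. 468–470), where the
localised pressure is split as `ζ p = p_{ρ,x} + q_{ρ,x}` through the Newtonian kernel: `p_{ρ,x}`
collects the terms whose data live where `∇ζ ≠ 0` and is bounded pointwise by
`C ρ⁻³ ∫_{B(x,ρ)} |p(s,z)| dz`, while `q_{ρ,x} = ∑ G * (ζ ∂ⱼ∂ₗ(uⱼuₗ))` is the Calderón–Zygmund part.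

As in the tree's `CKNPressureDuality` (the same splitting for (13.20), with the truncated
Newtonian kernel `Γ₀` at radii `(δ/2, δ)` and its smoothing remainder `λ = Δ((1-θ)Γ)` in place
of `G` and of the cut-off `ζ`), everything is done on the side of the test function, in
space–time, through the identity `∫∫ p θ = ∫∫ p Λθ - ∫∫ D²ₓΘ(u,u)`
(`IsDistributionalNSSolutionOn.integral_pressure_mul_test_eq`; `Θ(t,·) = N[θ(t,·)]`,
`Λθ(t,·) = λ ⋆ θ(t,·)`). This file identifies the **far part of the pressure** as a function:

* `pressureFarPart δ xB R' p t y = Λ[𝟙_{B(x_B,R')} p(t,·)](y) = ∫_{B(x_B,R')} λ(w - y) p(t,w) dw`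
  — the counterpart of `p_{ρ,x}` (a smooth average of the pressure slice over the ball,
  pointwise bounded by `sup|λ| ∫_{B(x_B,R')} |p(t)|`; `newtonFarSmoothing_indicator_eq_setIntegral`);
* `setIntegral_mul_newtonFarSmoothing_slice_eq` — **the adjoint identity**
  `∫∫_{I×B(x_B,R+δ)} p Λθ = ∫∫_{I×B(x_B,R)} (far part) θ` for `θ ∈ C_c^∞(I × B(x_B, R))`
  (Fubini; `λ` is even);
* `IsDistributionalNSSolutionOn.setIntegral_pressure_sub_farPart_mul_test_eq` — **the dual
  splitting**: `∫∫_{I×B(x_B,R)} (p - far part) θ = -∫∫_Ω D²ₓΘ(u, u)`, i.e. the near part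
  `q = p - (far part)` of the pressure on `I × B(x_B, R)` is, as a distribution, the
  Calderón–Zygmund expression `-∑ⱼₗ ∂ⱼ∂ₗ N[·]` tested against `uⱼuₗ` (Lemarié-Rieusset's
  `q_{ρ,x}`; with the truncated kernel the two boundary terms of p. 469 vanish identically on
  the smaller ball).

## References

* P. G. Lemarié-Rieusset, *The Navier–Stokes Problem in the 21st Century*, CRC Press (2016),
  pp. 468–469 (the splitting `ζp = p_{ρ,x} + q_{ρ,x}`). [LemarieRieusset2016]
* D. Gilbarg, N. S. Trudinger, *Elliptic partial differential equations of second order*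
  (2001), (2.16)–(2.17). [GilbargTrudinger2001]
-/

noncomputable section

open MeasureTheory Set Function Filter Topology TopologicalSpace Metric
open scoped NNReal ENNReal InnerProductSpace RealInnerProductSpace

namespace Literature.Analysis.FluidPDE

/-! ### The far kernel: evenness, boundedness, support -/

section Kernel

variable {δ : ℝ}

/-- `λ_{δ/2,δ}` vanishes off the closed ball of radius `δ`. [folklore] -/
theorem newtonFarLaplacian_half_eq_zero (hδ : 0 < δ) {z : EuclideanSpace ℝ (Fin 3)}
    (hz : δ < ‖z‖) : newtonFarLaplacian (δ / 2) δ z = 0 :=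
  newtonFarLaplacian_eq_zero_of_gt (by positivity) (by linarith) hz

/-- `λ_{δ/2,δ}` is even. [folklore] -/
theorem newtonFarLaplacian_half_sub_comm (hδ : 0 < δ) (y w : EuclideanSpace ℝ (Fin 3)) :
    newtonFarLaplacian (δ / 2) δ (y - w) = newtonFarLaplacian (δ / 2) δ (w - y) := by
  rw [newtonFarLaplacian_eq_profile (by positivity) (by linarith),
    newtonFarLaplacian_eq_profile (by positivity) (by linarith), norm_sub_rev]

/-- `λ_{δ/2,δ}` is continuous. [folklore] -/
theorem continuous_newtonFarLaplacian_half (hδ : 0 < δ) :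
    Continuous (newtonFarLaplacian (δ / 2) δ) :=
  continuous_newtonFarLaplacian (by positivity) (by linarith)

end Kernel

/-! ### The far part of the pressure -/

section FarPart

/-- **The far part of the pressure slice**: `Λ[𝟙_{B(x_B,R')} p(t,·)](y) =
∫ λ_{δ/2,δ}(z) (𝟙_{B(x_B,R')} p(t,·))(y - z) dz`, the smoothing remainder of the truncated Green
representation applied to the ball-restricted pressure slice (the counterpart, for the truncated
kernel, of `p_{ρ,x}` in Lemarié-Rieusset 2016, p. 469). A reducible abbreviation of
`newtonFarSmoothing`; arguments: the kernel scale `δ`, the ball `B(x_B, R')`, the pressure, the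
time, the point. [cite: LemarieRieusset2016, §13.9 p. 469] -/
abbrev pressureFarPart (δ : ℝ) (xB : EuclideanSpace ℝ (Fin 3)) (R' : ℝ)
    (p : ℝ → EuclideanSpace ℝ (Fin 3) → ℝ) (t : ℝ) (y : EuclideanSpace ℝ (Fin 3)) : ℝ :=
  newtonFarSmoothing (δ / 2) δ ((ball xB R').indicator (p t)) y

variable {δ R' : ℝ} {xB : EuclideanSpace ℝ (Fin 3)}

/-- The far part as an integral over the ball: `Λ[𝟙_B g](y) = ∫_B λ(w - y) g(w) dw`
(substitution `z = y - w` and evenness of `λ`). [folklore] -/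
theorem newtonFarSmoothing_indicator_eq_setIntegral (hδ : 0 < δ) (g : EuclideanSpace ℝ (Fin 3) → ℝ)
    (B : Set (EuclideanSpace ℝ (Fin 3))) (hB : MeasurableSet B) (y : EuclideanSpace ℝ (Fin 3)) :
    newtonFarSmoothing (δ / 2) δ (B.indicator g) y =
      ∫ w in B, newtonFarLaplacian (δ / 2) δ (w - y) * g w := by
  rw [newtonFarSmoothing_apply,
    ← integral_sub_left_eq_self (fun z => newtonFarLaplacian (δ / 2) δ z * B.indicator g (y - z))
      volume y, ← integral_indicator hB]
  refine integral_congr_ae (Eventually.of_forall fun w => ?_)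
  simp only [sub_sub_cancel]
  by_cases hw : w ∈ B
  · rw [indicator_of_mem hw, indicator_of_mem hw, newtonFarLaplacian_half_sub_comm hδ]
  · rw [indicator_of_notMem hw, indicator_of_notMem hw, mul_zero]

/-- **Pointwise bound for the far part**: `|Λ[𝟙_B g](y)| ≤ (sup |λ|) ∫_B |g|` for `g`
integrable on `B`. [folklore] -/
theorem abs_newtonFarSmoothing_indicator_le (hδ : 0 < δ) {Λmax : ℝ}
    (hΛ : ∀ z, |newtonFarLaplacian (δ / 2) δ z| ≤ Λmax) {g : EuclideanSpace ℝ (Fin 3) → ℝ}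
    {B : Set (EuclideanSpace ℝ (Fin 3))} (hB : MeasurableSet B) (hg : IntegrableOn g B volume)
    (y : EuclideanSpace ℝ (Fin 3)) :
    |newtonFarSmoothing (δ / 2) δ (B.indicator g) y| ≤ Λmax * ∫ w in B, |g w| := by
  rw [newtonFarSmoothing_indicator_eq_setIntegral hδ g B hB, ← integral_const_mul]
  refine (abs_integral_le_integral_abs).trans (integral_mono_of_nonneg
    (Eventually.of_forall fun w => abs_nonneg _) (hg.abs.const_mul Λmax)
    (Eventually.of_forall fun w => ?_))
  dsimp only
  rw [abs_mul]
  exact mul_le_mul_of_nonneg_right (hΛ _) (abs_nonneg _)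

end FarPart

/-! ### The adjoint identity `∫∫ p Λθ = ∫∫ (far part) θ` -/

section Adjoint

variable {a b R δ : ℝ} {xB : EuclideanSpace ℝ (Fin 3)} {p θ : ℝ → EuclideanSpace ℝ (Fin 3) → ℝ}

/-- `Λθ(t, y) = ∫ λ(y - y') θ(t, y') dy'` (substitution in the convolution). [folklore] -/
theorem newtonFarSmoothing_eq_integral_sub (δ : ℝ) (g : EuclideanSpace ℝ (Fin 3) → ℝ)
    (y : EuclideanSpace ℝ (Fin 3)) :
    newtonFarSmoothing (δ / 2) δ g y = ∫ y', newtonFarLaplacian (δ / 2) δ (y - y') * g y' := by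
  rw [newtonFarSmoothing_apply,
    ← integral_sub_left_eq_self (fun z => newtonFarLaplacian (δ / 2) δ z * g (y - z)) volume y]
  refine integral_congr_ae (Eventually.of_forall fun y' => ?_)
  simp only [sub_sub_cancel]

/-- **The adjoint identity for the smoothing remainder** (Fubini; the kernel `λ_{δ/2,δ}` is
even): for `p` integrable on `I × B(x_B, R + δ)` and `θ ∈ C_c^∞(I × B(x_B, R))`,
`∫∫_{I×B(x_B,R+δ)} p(t,y) Λ[θ(t,·)](y) = ∫∫_{I×B(x_B,R)} Λ[𝟙_{B(x_B,R+δ)} p(t,·)](y) θ(t,y)`. [folklore] -/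
theorem integrableOn_and_setIntegral_mul_newtonFarSmoothing_slice_eq (hδ : 0 < δ)
    (hp : IntegrableOn (uncurry p) (Ioo a b ×ˢ ball xB (R + δ)) volume)
    (hθ : IsSpaceTimeTestOn (⟨Ioo a b ×ˢ ball xB R, isOpen_Ioo.prod isOpen_ball⟩ :
      Opens (ℝ × EuclideanSpace ℝ (Fin 3))) θ) :
    IntegrableOn (fun z : ℝ × EuclideanSpace ℝ (Fin 3) =>
        pressureFarPart δ xB (R + δ) p z.1 z.2 * θ z.1 z.2) (Ioo a b ×ˢ ball xB R) volume ∧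
    ∫ z in Ioo a b ×ˢ ball xB (R + δ), p z.1 z.2 * newtonFarSmoothing (δ / 2) δ (θ z.1) z.2 =
      ∫ z in Ioo a b ×ˢ ball xB R, pressureFarPart δ xB (R + δ) p z.1 z.2 * θ z.1 z.2 := by
  -- notation
  set I : Set ℝ := Ioo a b with hI
  set B : Set (EuclideanSpace ℝ (Fin 3)) := ball xB R with hB
  set B' : Set (EuclideanSpace ℝ (Fin 3)) := ball xB (R + δ) with hB'
  set S : Set (ℝ × EuclideanSpace ℝ (Fin 3)) := I ×ˢ B with hS
  set S' : Set (ℝ × EuclideanSpace ℝ (Fin 3)) := I ×ˢ B' with hS'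
  set lam : EuclideanSpace ℝ (Fin 3) → ℝ := newtonFarLaplacian (δ / 2) δ with hlam
  have hS'm : MeasurableSet S' := measurableSet_Ioo.prod measurableSet_ball
  have hSm : MeasurableSet S := measurableSet_Ioo.prod measurableSet_ball
  -- the kernel: continuous and bounded
  have hlamc : Continuous lam := continuous_newtonFarLaplacian_half hδ
  obtain ⟨Λmax, hΛmax⟩ := hlamc.bounded_above_of_compact_support
    (hasCompactSupport_newtonFarLaplacian (by positivity) (by linarith))
  have hΛ0 : 0 ≤ Λmax := (norm_nonneg _).trans (hΛmax 0)
  -- the test function: continuous, bounded, slices supported in `B`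
  have hθc : Continuous (uncurry θ) := hθ.contDiff.continuous
  obtain ⟨Cθ, hCθ⟩ := hθc.bounded_above_of_compact_support hθ.hasCompactSupport
  have hCθ' : ∀ t y, ‖θ t y‖ ≤ Cθ := fun t y => hCθ (t, y)
  have hCθ0 : 0 ≤ Cθ := (norm_nonneg _).trans (hCθ' 0 0)
  have hθ0 : ∀ t y, (t, y) ∉ S → θ t y = 0 := fun t y h => hθ.apply_eq_zero h
  have hθB : ∀ t y, y ∉ B → θ t y = 0 := fun t y hy => hθ0 t y fun h => hy h.2
  -- the restricted pressure as a function on the whole space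
  set P : ℝ × EuclideanSpace ℝ (Fin 3) → ℝ := S'.indicator (uncurry p) with hP
  have hPi : Integrable P (volume : Measure (ℝ × EuclideanSpace ℝ (Fin 3))) :=
    hp.integrable_indicator hS'm
  have hPsplit : ∀ t y, P (t, y) = I.indicator (fun _ => (1 : ℝ)) t * B'.indicator (p t) y := by
    intro t y
    by_cases ht : t ∈ I
    · by_cases hy : y ∈ B'
      · rw [hP, indicator_of_mem (mk_mem_prod ht hy), indicator_of_mem ht, indicator_of_mem hy,
          one_mul]; rfl
      · rw [hP, indicator_of_notMem (fun h => hy h.2), indicator_of_notMem hy, mul_zero]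
    · rw [hP, indicator_of_notMem (fun h => ht h.1), indicator_of_notMem ht, zero_mul]
  -- the product measure and the regrouping equivalence `((t, y), y') ↦ ((t, y'), y)`
  set μ : Measure ((ℝ × EuclideanSpace ℝ (Fin 3)) × EuclideanSpace ℝ (Fin 3)) :=
    (volume : Measure (ℝ × EuclideanSpace ℝ (Fin 3))).prod (volume : Measure (EuclideanSpace ℝ (Fin 3)))
    with hμ
  set e : (ℝ × EuclideanSpace ℝ (Fin 3)) × EuclideanSpace ℝ (Fin 3) ≃ᵐ
      (ℝ × EuclideanSpace ℝ (Fin 3)) × EuclideanSpace ℝ (Fin 3) :=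
    (MeasurableEquiv.prodAssoc.trans ((MeasurableEquiv.refl ℝ).prodCongr MeasurableEquiv.prodComm)).trans
      MeasurableEquiv.prodAssoc.symm with he_def
  have he_apply : ∀ w : (ℝ × EuclideanSpace ℝ (Fin 3)) × EuclideanSpace ℝ (Fin 3),
      e w = ((w.1.1, w.2), w.1.2) := fun w => rfl
  have he : MeasurePreserving e μ μ := by
    have h1 : MeasurePreserving (MeasurableEquiv.prodAssoc :
        (ℝ × EuclideanSpace ℝ (Fin 3)) × EuclideanSpace ℝ (Fin 3) ≃ᵐ
          ℝ × EuclideanSpace ℝ (Fin 3) × EuclideanSpace ℝ (Fin 3)) μ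
        ((volume : Measure ℝ).prod ((volume : Measure (EuclideanSpace ℝ (Fin 3))).prod volume)) := by
      rw [hμ, Measure.volume_eq_prod]
      exact measurePreserving_prodAssoc volume volume volume
    have h2 : MeasurePreserving ((MeasurableEquiv.refl ℝ).prodCongr
        (MeasurableEquiv.prodComm : EuclideanSpace ℝ (Fin 3) × EuclideanSpace ℝ (Fin 3) ≃ᵐ
          EuclideanSpace ℝ (Fin 3) × EuclideanSpace ℝ (Fin 3)))
        ((volume : Measure ℝ).prod ((volume : Measure (EuclideanSpace ℝ (Fin 3))).prod volume))
        ((volume : Measure ℝ).prod ((volume : Measure (EuclideanSpace ℝ (Fin 3))).prod volume)) :=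
      (MeasurePreserving.id volume).prod Measure.measurePreserving_swap
    exact (h1.trans h2).trans h1.symm
  -- the triple integrand in the variables `((t, y), y')`
  set Ψ : (ℝ × EuclideanSpace ℝ (Fin 3)) × EuclideanSpace ℝ (Fin 3) → ℝ :=
    fun q => P q.1 * (lam (q.1.2 - q.2) * θ q.1.1 q.2) with hΨ
  have hKc : Continuous fun q : (ℝ × EuclideanSpace ℝ (Fin 3)) × EuclideanSpace ℝ (Fin 3) =>
      lam (q.1.2 - q.2) * θ q.1.1 q.2 :=
    (hlamc.comp ((continuous_snd.comp continuous_fst).sub continuous_snd)).mul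
      (hθc.comp ((continuous_fst.comp continuous_fst).prodMk continuous_snd))
  have hΨm : AEStronglyMeasurable Ψ μ := hPi.aestronglyMeasurable.comp_fst.mul hKc.aestronglyMeasurable
  -- integrability of `Ψ`
  have hKbd : ∀ (z : ℝ × EuclideanSpace ℝ (Fin 3)) (y' : EuclideanSpace ℝ (Fin 3)),
      ‖lam (z.2 - y') * θ z.1 y'‖ ≤ Λmax * B.indicator (fun _ => Cθ) y' := by
    intro z y'
    by_cases hy : y' ∈ B
    · rw [indicator_of_mem hy, norm_mul]
      exact mul_le_mul (hΛmax _) (hCθ' _ _) (norm_nonneg _) hΛ0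
    · rw [hθB z.1 y' hy, mul_zero, norm_zero, indicator_of_notMem hy, mul_zero]
  have hBvol : volume B < ∞ := measure_ball_lt_top
  have hindB : Integrable (B.indicator fun _ : EuclideanSpace ℝ (Fin 3) => Cθ)
      (volume : Measure (EuclideanSpace ℝ (Fin 3))) :=
    (integrable_indicator_iff measurableSet_ball).2 (integrableOn_const hBvol.ne)
  have hΨi : Integrable Ψ μ := by
    rw [integrable_prod_iff hΨm]
    constructor
    · refine Eventually.of_forall fun z => ?_
      have hcz : Continuous fun y' => lam (z.2 - y') * θ z.1 y' :=
        (hlamc.comp (continuous_const.sub continuous_id)).mul (hθc.comp (Continuous.prodMk_right z.1))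
      refine (Integrable.mono' (hindB.const_mul Λmax) hcz.aestronglyMeasurable
        (Eventually.of_forall fun y' => hKbd z y')).const_mul (P z) |>.congr ?_
      exact Eventually.of_forall fun y' => rfl
    · have hbound : ∀ z : ℝ × EuclideanSpace ℝ (Fin 3), ‖∫ y', ‖Ψ (z, y')‖‖ ≤
          (Λmax * (Cθ * (volume B).toReal)) * ‖P z‖ := by
        intro z
        rw [Real.norm_eq_abs, abs_of_nonneg (integral_nonneg fun _ => norm_nonneg _)]
        calc ∫ y', ‖Ψ (z, y')‖ = ∫ y', ‖P z‖ * ‖lam (z.2 - y') * θ z.1 y'‖ := by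
              refine integral_congr_ae (Eventually.of_forall fun y' => ?_); rw [hΨ]; dsimp only
              rw [norm_mul]
          _ = ‖P z‖ * ∫ y', ‖lam (z.2 - y') * θ z.1 y'‖ := integral_const_mul _ _
          _ ≤ ‖P z‖ * ∫ y', Λmax * B.indicator (fun _ => Cθ) y' := by
              refine mul_le_mul_of_nonneg_left (integral_mono_of_nonneg
                (Eventually.of_forall fun _ => norm_nonneg _) (hindB.const_mul Λmax)
                (Eventually.of_forall (hKbd z))) (norm_nonneg _)
          _ = (Λmax * (Cθ * (volume B).toReal)) * ‖P z‖ := by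
              rw [integral_const_mul, integral_indicator measurableSet_ball, setIntegral_const,
                smul_eq_mul, measureReal_def, hB]
              ring
      exact Integrable.mono' (hPi.norm.const_mul _) (hΨm.norm.integral_prod_right')
        (Eventually.of_forall hbound)
  -- Step 1: the left-hand side is `∫ Ψ`
  have hL : ∫ z in S', p z.1 z.2 * newtonFarSmoothing (δ / 2) δ (θ z.1) z.2 = ∫ q, Ψ q ∂μ := by
    rw [hμ, integral_prod _ hΨi, ← integral_indicator hS'm]
    refine integral_congr_ae (Eventually.of_forall fun z => ?_)
    rw [hΨ]
    dsimp only
    rw [integral_const_mul]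
    by_cases hz : z ∈ S'
    · rw [indicator_of_mem hz, hP, indicator_of_mem hz, newtonFarSmoothing_eq_integral_sub]; rfl
    · rw [indicator_of_notMem hz, hP, indicator_of_notMem hz, zero_mul]
  -- Step 2: regroup the variables
  have hR1 : ∫ q, Ψ q ∂μ = ∫ w, Ψ (e w) ∂μ := (he.integral_comp e.measurableEmbedding Ψ).symm
  -- Step 3: the regrouped integrand, integrated first in `y`
  have hΦi : Integrable (fun w => Ψ (e w)) μ := he.integrable_comp_emb e.measurableEmbedding |>.2 hΨi
  have hinner : ∀ w₁ : ℝ × EuclideanSpace ℝ (Fin 3), ∫ y, Ψ (e (w₁, y)) =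
      S.indicator (fun z : ℝ × EuclideanSpace ℝ (Fin 3) =>
        pressureFarPart δ xB (R + δ) p z.1 z.2 * θ z.1 z.2) w₁ := by
    rintro ⟨t, y'⟩
    have e1 : ∀ y, Ψ (e ((t, y'), y)) = θ t y' * (I.indicator (fun _ => (1 : ℝ)) t *
        (B'.indicator (p t) y * lam (y - y'))) := fun y => by
      rw [he_apply, hΨ]; dsimp only; rw [hPsplit]; ring
    simp_rw [e1]
    rw [integral_const_mul, integral_const_mul]
    have e2 : ∫ y, B'.indicator (p t) y * lam (y - y') =
        pressureFarPart δ xB (R + δ) p t y' := by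
      rw [pressureFarPart, newtonFarSmoothing_indicator_eq_setIntegral hδ _ _ measurableSet_ball,
        ← integral_indicator measurableSet_ball]
      refine integral_congr_ae (Eventually.of_forall fun y => ?_)
      dsimp only
      by_cases hy : y ∈ B'
      · rw [indicator_of_mem hy, indicator_of_mem hy, mul_comm]
      · rw [indicator_of_notMem hy, indicator_of_notMem hy, zero_mul]
    rw [e2]
    by_cases ht : t ∈ I
    · by_cases hy' : y' ∈ B
      · rw [indicator_of_mem ht, indicator_of_mem (mk_mem_prod ht hy'), one_mul, mul_comm]
      · rw [hθB t y' hy', zero_mul, indicator_of_notMem (fun h => hy' h.2)]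
    · rw [indicator_of_notMem ht, zero_mul, mul_zero, indicator_of_notMem (fun h => ht h.1)]
  have hR2 : ∫ w, Ψ (e w) ∂μ =
      ∫ z in S, pressureFarPart δ xB (R + δ) p z.1 z.2 * θ z.1 z.2 := by
    rw [hμ, integral_prod _ hΦi, ← integral_indicator hSm]
    exact integral_congr_ae (Eventually.of_forall hinner)
  refine ⟨?_, by rw [hL, hR1, hR2]⟩
  -- integrability of the far part against the test function
  have hint := hΦi.integral_prod_left
  have hfun : (fun x : ℝ × EuclideanSpace ℝ (Fin 3) => ∫ y, Ψ (e (x, y))) =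
      S.indicator (fun z : ℝ × EuclideanSpace ℝ (Fin 3) =>
        pressureFarPart δ xB (R + δ) p z.1 z.2 * θ z.1 z.2) := funext hinner
  rw [hfun] at hint
  exact (integrable_indicator_iff hSm).1 hint

/-- The adjoint identity alone (second component of
`integrableOn_and_setIntegral_mul_newtonFarSmoothing_slice_eq`). [folklore] -/
theorem setIntegral_mul_newtonFarSmoothing_slice_eq (hδ : 0 < δ)
    (hp : IntegrableOn (uncurry p) (Ioo a b ×ˢ ball xB (R + δ)) volume)
    (hθ : IsSpaceTimeTestOn (⟨Ioo a b ×ˢ ball xB R, isOpen_Ioo.prod isOpen_ball⟩ :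
      Opens (ℝ × EuclideanSpace ℝ (Fin 3))) θ) :
    ∫ z in Ioo a b ×ˢ ball xB (R + δ), p z.1 z.2 * newtonFarSmoothing (δ / 2) δ (θ z.1) z.2 =
      ∫ z in Ioo a b ×ˢ ball xB R, pressureFarPart δ xB (R + δ) p z.1 z.2 * θ z.1 z.2 :=
  (integrableOn_and_setIntegral_mul_newtonFarSmoothing_slice_eq hδ hp hθ).2

end Adjoint

/-! ### The dual splitting of the pressure -/

section Splitting

variable {Ω : Opens (ℝ × EuclideanSpace ℝ (Fin 3))} {ν : ℝ}
  {f u : ℝ → EuclideanSpace ℝ (Fin 3) → EuclideanSpace ℝ (Fin 3)}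
  {p θ : ℝ → EuclideanSpace ℝ (Fin 3) → ℝ} {a b R δ : ℝ} {xB : EuclideanSpace ℝ (Fin 3)}

/-- **The dual splitting of the pressure** (Lemarié-Rieusset 2016, pp. 468–469, the splitting
`ζp = p_{ρ,x} + q_{ρ,x}`, in the truncated-kernel, test-function-side form of the tree). Let
`(u, p)` be a distributional Navier–Stokes solution on `Ω` with `f ∈ L¹_loc(Ω)`, `div f = 0`
(iterated form); let `I × B(x_B, R + δ) ⊆ Ω` (`δ > 0`) with `p` integrable there, and
`θ ∈ C_c^∞(I × B(x_B, R))`. Then, with the far part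
`h(t,y) = Λ_{δ/2,δ}[𝟙_{B(x_B,R+δ)} p(t,·)](y)` (`pressureFarPart`) and `Θ(t,·) = N_{δ/2,δ}[θ(t,·)]`,
`∫∫_{I×B(x_B,R)} (p - h) θ = -∫∫_Ω D²ₓΘ(u, u)`:
the near part `p - h` of the pressure is the Calderón–Zygmund part (Lemarié-Rieusset's
`q_{ρ,x}`) in dual form. [cite: LemarieRieusset2016, §13.9 p. 469] -/
theorem IsDistributionalNSSolutionOn.setIntegral_pressure_sub_farPart_mul_test_eq
    (hns : IsDistributionalNSSolutionOn Ω ν f u p)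
    (hfi : LocallyIntegrableOn (uncurry f) (Ω : Set (ℝ × EuclideanSpace ℝ (Fin 3))) volume)
    (hdivf : ∀ φ : ℝ → EuclideanSpace ℝ (Fin 3) → ℝ, IsSpaceTimeTestOn Ω φ →
      ∫ t, ∫ x, ⟪f t x, gradient (φ t) x⟫ = 0)
    (hδ : 0 < δ) (hsub : Ioo a b ×ˢ ball xB (R + δ) ⊆ (Ω : Set (ℝ × EuclideanSpace ℝ (Fin 3))))
    (hp : IntegrableOn (uncurry p) (Ioo a b ×ˢ ball xB (R + δ)) volume)
    (hθ : IsSpaceTimeTestOn (⟨Ioo a b ×ˢ ball xB R, isOpen_Ioo.prod isOpen_ball⟩ :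
      Opens (ℝ × EuclideanSpace ℝ (Fin 3))) θ) :
    ∫ z in Ioo a b ×ˢ ball xB R,
        (p z.1 z.2 - pressureFarPart δ xB (R + δ) p z.1 z.2) * θ z.1 z.2 =
      -∫ z in (Ω : Set (ℝ × EuclideanSpace ℝ (Fin 3))),
        fderiv ℝ (fderiv ℝ (newtonNearPotential (δ / 2) δ (θ z.1))) z.2 (u z.1 z.2) (u z.1 z.2) := by
  have h₀ : (0 : ℝ) ≤ δ / 2 := by positivity
  have h₁ : δ / 2 < δ := by linarith
  set S : Set (ℝ × EuclideanSpace ℝ (Fin 3)) := Ioo a b ×ˢ ball xB R with hS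
  set S' : Set (ℝ × EuclideanSpace ℝ (Fin 3)) := Ioo a b ×ˢ ball xB (R + δ) with hS'
  have hSm : MeasurableSet S := measurableSet_Ioo.prod measurableSet_ball
  have hS'm : MeasurableSet S' := measurableSet_Ioo.prod measurableSet_ball
  have hSS' : S ⊆ S' := prod_mono Subset.rfl (ball_subset_ball (by linarith))
  have hΩm : MeasurableSet (Ω : Set (ℝ × EuclideanSpace ℝ (Fin 3))) := Ω.isOpen.measurableSet
  -- the tested pressure equation
  have key := hns.integral_pressure_mul_test_eq hfi hdivf hδ hsub hθ
  -- `p θ` lives on `S`, `p Λθ` on `S'`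
  have h1 : ∫ z in (Ω : Set (ℝ × EuclideanSpace ℝ (Fin 3))), p z.1 z.2 * θ z.1 z.2 =
      ∫ z in S, p z.1 z.2 * θ z.1 z.2 := by
    refine setIntegral_eq_of_subset_of_forall_sdiff_eq_zero hΩm (hSS'.trans hsub) fun z hz => ?_
    rw [hθ.apply_eq_zero (show z ∉ S from hz.2), mul_zero]
  obtain ⟨-, hΛsupp⟩ := tsupport_newtonFarSmoothing_slice_subset (ρ₀ := δ / 2) hθ h₀ h₁
  have h2 : ∫ z in (Ω : Set (ℝ × EuclideanSpace ℝ (Fin 3))),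
      p z.1 z.2 * newtonFarSmoothing (δ / 2) δ (θ z.1) z.2 =
      ∫ z in S', p z.1 z.2 * newtonFarSmoothing (δ / 2) δ (θ z.1) z.2 := by
    refine setIntegral_eq_of_subset_of_forall_sdiff_eq_zero hΩm hsub fun z hz => ?_
    have hz' : z ∉ tsupport (uncurry fun t => newtonFarSmoothing (δ / 2) δ (θ t)) :=
      fun h => hz.2 (hΛsupp h)
    rw [show newtonFarSmoothing (δ / 2) δ (θ z.1) z.2 =
      uncurry (fun t => newtonFarSmoothing (δ / 2) δ (θ t)) z from rfl,
      image_eq_zero_of_notMem_tsupport hz', mul_zero]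
  -- the adjoint identity and integrability
  obtain ⟨hfar, hadj⟩ := integrableOn_and_setIntegral_mul_newtonFarSmoothing_slice_eq hδ hp hθ
  -- integrability of `p θ` on `S`
  obtain ⟨Cθ, hCθ⟩ := hθ.contDiff.continuous.bounded_above_of_compact_support hθ.hasCompactSupport
  have hpθ : IntegrableOn (fun z : ℝ × EuclideanSpace ℝ (Fin 3) => p z.1 z.2 * θ z.1 z.2) S volume := by
    have h := (hp.mono_set hSS').bdd_mul hθ.contDiff.continuous.aestronglyMeasurable.restrict
      (Eventually.of_forall fun z => hCθ z)
    refine h.congr (Eventually.of_forall fun z => ?_)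
    show uncurry θ z * uncurry p z = p z.1 z.2 * θ z.1 z.2
    simp only [uncurry]; ring
  have hsplit : ∀ z : ℝ × EuclideanSpace ℝ (Fin 3),
      (p z.1 z.2 - pressureFarPart δ xB (R + δ) p z.1 z.2) * θ z.1 z.2 =
        p z.1 z.2 * θ z.1 z.2 - pressureFarPart δ xB (R + δ) p z.1 z.2 * θ z.1 z.2 := fun z => by ring
  simp_rw [hsplit]
  rw [integral_sub hpθ hfar, ← hadj, ← h1, ← h2, key]
  ring

end Splitting

end Literature.Analysis.FluidPDE
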